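/-
COR-CM (cells pub-hodgecm / pub-hodgecm2, stage 2 of the Hodge ladder) — Δ2 BRIDGE, COORDINATOR «Δ2 RESTRUCTURE FOR SPEED» 2026-08-23,
sublemma S1 (seat d2bridge-prove-1), companion «S1b»: the INPUT of the S1 core `exists_liuCMRecord_of_cmDatum` (`CorCM/D2Bridge/HcmS1LiuCMRecord.lean`)
— Liu's eigenclass `α ∈ H¹_{B,τ'}(A_μ, ℂ)` on which `M_μ` acts «via the inclusion `M_μ ↪ ℂ`» — EXISTS and its subspace is a LINE, for every
object of [Liu 2021] Def. 4.5 (2) AS PRINTED (`Def45.CMDatum`).  This is the first sentence of the PROOF of [Liu2021] Thm. 4.18 (l. 2246–2250)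
PROVED at the as-printed datum, so that the pin's `Map43RationalData.α ∕ α_mem ∕ α_ne` and the S1 record's `α₀` are supplied by a theorem,
not a binder.  Theorems only; nothing landed is edited or restated.  FRAMING: HC_CM is NOT proved; «Δ2 BRIDGE CLOSED» is NOT claimed.
-/
import Summits.HodgeConjecture.CorCM.B01.Transposition.Item6PinMatchDef45Principal
import Summits.HodgeConjecture.CorCM.B01.Transposition.Item6PinMatchDef45BC
import HarnessLib

set_option autoImplicit false

/-!
# Δ2 bridge, S1b: Liu's eigenclass on `A_μ ⊗_{E,ι₁} ℂ` exists and spans a line ([Liu2021] proof of Thm. 4.18, first sentence)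

[Liu2021] proof of Thm. 4.18 (`FJcycle.tex` l. 2246–2250), VERBATIM: «Take an embedding `τ' : E → ℂ` in `Φ_μ`.  It is clear that the maximal
subspace of the complex vector space `H¹_{B,τ'}(A_μ, ℂ)` over which `M_μ` acts via the inclusion `M_μ ↪ ℂ` has dimension `1`.  We choose a
basis `α` of this subspace.»

WHAT THIS FILE PROVES (`Summit.HodgeConjecture.CorCM.D2Bridge`), for a CM field `L` Galois over `ℚ`, the pin `ι₁ : L → ℂ`, a
conjugate-symplectic weight-one `μ` and ONE object `X = (A_μ, i_μ, λ_μ, r_μ)` of [Liu2021] Def. 4.5 (2) AS PRINTED (`Def45.CMDatum`, item6-p1),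
with `i_{μ,ℂ} := End⁰(⊗ℂ) ∘ i_μ : M_μ → End⁰(A_μ ⊗_{L,ι₁} ℂ)`:
* `finrank_eigenline_complexAction_liu_eq_one` — «has dimension `1`»: the `(M_μ ⊆ ℂ)`-eigenline of `complexAction i_{μ,ℂ}` on
  `H¹(A_μ ⊗ ℂ (ℂ); ℂ)` is a LINE (no hypothesis `τ' ∈ Φ_μ` is needed: EVERY embedding of `M_μ` occurs once in `H¹` of a CM abelian variety of
  full degree);
* `exists_liu_eigenclass` — «we choose a basis `α`»: there is `α₀ ∈ ℂ ⊗_ℚ H¹(A_μ ⊗ ℂ (ℂ); ℚ)`, `α₀ ≠ 0`, with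
  `(i_{μ,ℂ}(k)^* ⊗ ℂ) α₀ = k • α₀` for every `k ∈ M_μ` — EXACTLY the hypotheses `(α₀, hα₀, hα₀0)` of the S1 core
  `exists_liuCMRecord_of_cmDatum` and the shape of `Map43RationalData.α ∕ α_mem ∕ α_ne` at `L := H¹(A_μ ⊗ ℂ (ℂ); ℚ)`.
KERNEL: Def. 4.5 (2) ⇒ the principal model `B` of `A_μ ⊗ ℂ` (isogeny pair `(u, v, m)`) realises a CM type of `M_μ` with the transported
action (`Model.exists_principal_isCMTypeRealisation_baseChange_of_det45`, p301919 chain, `hW ∕ hdetBC` discharged by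
`cotangent_hodge10_comparison_holds` ∕ `det_cotangentMap_baseChange_law`); on `B` every eigenline is a line (`IsCMTypeRealisation`, clause 4);
`u^*` and `v^*` carry `τ`-eigenclasses to `τ`-eigenclasses injectively (`complexBetti_map_mem_eigenline_transport`,
`complexBetti_map_injective_of_comp_eq_nsmul` for the pair and the reversed pair, `endAlgebraTransport_transport`).
HC_CM is NOT proved.

References: Y. Liu, *Fourier–Jacobi cycles and arithmetic relative trace formula*, Camb. J. Math. 9 (2021) = arXiv:2102.11518, Def. 4.5 (2)
(`FJcycle.tex` l. 1944–1951), proof of Thm. 4.18 l. 2246–2250; G. Shimura, *Abelian Varieties with Complex Multiplication and Modular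
Functions* (1998) §5.2, §7.1 Prop. 7; D. Mumford, *Abelian Varieties* (1970) §19.
-/

noncomputable section

open scoped TensorProduct

namespace Summit.HodgeConjecture.CorCM.D2Bridge

open CategoryTheory NumberField
open Literature.AlgebraicGeometry.Motives Literature.AlgebraicGeometry.HodgeTheory
open Literature.AlgebraicGeometry.ComplexMultiplication Literature.AlgebraicGeometry.Milne1999
open Literature.AlgebraicGeometry.Motives.AbelianVariety
open Literature.NumberTheory.ComplexMultiplication Literature.NumberTheory.Automorphic
open Literature.NumberTheory.Automorphic.IdeleClassGroup Literature.NumberTheory.Automorphic.PicardCM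
open Literature.NumberTheory.Automorphic.Liu2021
open Summit.HodgeConjecture.CorCM.Model

/-! ## §1 Eigenlines along an isogeny pair: dimensions agree -/

section Transport

variable {K : Type} [Field K] [NumberField K] {A B : AbelianVariety ℂ}
  {u : A ⟶ B} {v : B ⟶ A} {m : ℕ} (hm : 0 < m) (huv : u ≫ v = m • 𝟙 A) (hvu : v ≫ u = m • 𝟙 B)
  (φ : K →+* A.endAlgebra)

include hm huv hvu in
/-- **`u^*` carries `τ`-eigenclasses of the transported action back to `τ`-eigenclasses of `φ`** (the reversed pair `(v, u)` of
`complexBetti_map_mem_eigenline_transport`, the double transport being the identity, `endAlgebraTransport_transport`).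
[cite: MumfordAV1970, §19 Remark p. 169] -/
theorem complexBetti_map_mem_eigenline_transport_symm {τ : K →+* ℂ} {w : complexBetti B.X 1}
    (hw : w ∈ eigenline (complexAction ((endAlgebraTransport u v m hm huv hvu).toRingHom.comp φ)) τ) :
    (complexBetti.map u.hom.hom.hom 1).hom w ∈ eigenline (complexAction φ) τ := by
  have h := complexBetti_map_mem_eigenline_transport hm hvu huv ((endAlgebraTransport u v m hm huv hvu).toRingHom.comp φ) hw
  have hφ : (endAlgebraTransport v u m hm hvu huv).toRingHom.comp ((endAlgebraTransport u v m hm huv hvu).toRingHom.comp φ) = φ :=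
    RingHom.ext fun k => endAlgebraTransport_transport hm huv hvu (φ k)
  rwa [hφ] at h

include hm huv hvu in
/-- **Eigenlines have the same dimension along an isogeny pair**: `dim eigenline (complexAction φ) τ = dim eigenline (complexAction φ_B) τ`
(`v^*` and `u^*` restrict to injective linear maps between the two, both finite-dimensional). [cite: MumfordAV1970, §19 Remark p. 169] -/
theorem finrank_eigenline_complexAction_eq_of_isogenyPair (τ : K →+* ℂ) :
    Module.finrank ℂ (eigenline (complexAction φ) τ) =
      Module.finrank ℂ (eigenline (complexAction ((endAlgebraTransport u v m hm huv hvu).toRingHom.comp φ)) τ) := by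
  haveI := finite_complexBetti_abelianVariety A 1
  haveI := finite_complexBetti_abelianVariety B 1
  refine le_antisymm ?_ ?_
  · refine LinearMap.finrank_le_finrank_of_injective
      (f := ((complexBetti.map v.hom.hom.hom 1).hom.restrict fun x hx =>
        complexBetti_map_mem_eigenline_transport hm huv hvu φ hx)) fun x y hxy => ?_
    exact Subtype.ext (complexBetti_map_injective_of_comp_eq_nsmul hm huv (congrArg Subtype.val hxy))
  · refine LinearMap.finrank_le_finrank_of_injective
      (f := ((complexBetti.map u.hom.hom.hom 1).hom.restrict fun x hx =>
        complexBetti_map_mem_eigenline_transport_symm hm huv hvu φ hx)) fun x y hxy => ?_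
    exact Subtype.ext (complexBetti_map_injective_of_comp_eq_nsmul hm hvu (congrArg Subtype.val hxy))

end Transport

/-! ## §2 At [Liu2021] Def. 4.5 (2): the eigenclass of the proof of Thm. 4.18 -/

/-- **«the maximal subspace of `H¹_{B,τ'}(A_μ, ℂ)` over which `M_μ` acts via the inclusion `M_μ ↪ ℂ` has dimension `1`»** ([Liu2021] proof of
Thm. 4.18, l. 2246–2248), PROVED for every object `X = (A_μ, i_μ, …)` of Def. 4.5 (2) AS PRINTED: the `(M_μ ⊆ ℂ)`-eigenline of
`complexAction i_{μ,ℂ}` on `H¹(A_μ ⊗_{L,ι₁} ℂ (ℂ); ℂ)` is a line.  KERNEL: the principal model `B` of `A_μ ⊗ ℂ` realises a CM type of `M_μ` on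
`H¹` (Def. 4.5 (2) chain, p301919, principal tail), where every eigenline is a line; §1.
[cite: Liu2021, proof of Thm. 4.18 (FJcycle.tex l. 2246–2248), Def. 4.5 (2) (l. 1944–1951)] [cite: Shimura1998, §5.2 (pp. 36–37) and §7.1 Proposition 7 (p. 47)] -/
theorem finrank_eigenline_complexAction_liu_eq_one
    {L : Type} [Field L] [NumberField L] [IsCMField L] [IsGalois ℚ L] (ι₁ : L →+* ℂ)
    {μ : IdeleClassGroup L →ₜ* Circle} {hμ : IsConjugateSymplectic L μ} {hw : HasWeight L μ 1} {Car : Def45.Carriers L μ}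
    (X : Def45.CMDatum (AlgHom.id ℚ L) ι₁ hμ hw Car) :
    letI := ι₁.toAlgebra
    haveI := hμ.numberField_muAlgValueField
    Module.finrank ℂ (eigenline
      (complexAction ((AbelianVariety.endAlgebra.mapRingHom (X.A.endBaseChange ℂ)).toRingHom.comp X.i))
      (muAlgValueField L μ).subtype) = 1 := by
  letI := ι₁.toAlgebra
  haveI := hμ.numberField_muAlgValueField
  obtain ⟨B, u, v, m, hm, huv, hvu, ιB, -, -, -, hreal⟩ :=
    exists_principal_isCMTypeRealisation_baseChange_of_det45 cotangent_hodge10_comparison_holds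
      det_cotangentMap_baseChange_law ι₁ hμ X.A X.i X.finrank_eq X.det45
      (Def45.incl (AlgHom.id ℚ L) ι₁ hμ) (Def45.coe_incl (AlgHom.id ℚ L) ι₁ hμ)
  rw [finrank_eigenline_complexAction_eq_of_isogenyPair hm huv hvu _ (muAlgValueField L μ).subtype]
  exact (hreal.2.2.2 (muAlgValueField L μ).subtype).1

/-- **«We choose a basis `α` of this subspace»** ([Liu2021] proof of Thm. 4.18, l. 2250), PROVED for every object of Def. 4.5 (2) AS PRINTED, in
the rational-tensor currency of the pin: there is `α₀ ∈ ℂ ⊗_ℚ H¹(A_μ ⊗_{L,ι₁} ℂ (ℂ); ℚ)`, `α₀ ≠ 0`, on which `M_μ` acts through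
`i_{μ,ℂ}(k)^* ⊗ ℂ` by the scalar `k ∈ M_μ ⊆ ℂ` — EXACTLY the input `(α₀, hα₀, hα₀0)` of the S1 core `exists_liuCMRecord_of_cmDatum` and the shape of
`Map43RationalData.α ∕ α_mem ∕ α_ne`.  KERNEL: a non-zero vector of the line of `finrank_eigenline_complexAction_liu_eq_one`, read through
`β : ℂ ⊗ H¹(ℚ) ≃ H¹(ℂ)` (`complexAction_βA`). [cite: Liu2021, proof of Thm. 4.18 (FJcycle.tex l. 2246–2250), Def. 4.5 (2) (l. 1944–1951)] -/
theorem exists_liu_eigenclass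
    {L : Type} [Field L] [NumberField L] [IsCMField L] [IsGalois ℚ L] (ι₁ : L →+* ℂ)
    {μ : IdeleClassGroup L →ₜ* Circle} {hμ : IsConjugateSymplectic L μ} {hw : HasWeight L μ 1} {Car : Def45.Carriers L μ}
    (X : Def45.CMDatum (AlgHom.id ℚ L) ι₁ hμ hw Car) :
    letI := ι₁.toAlgebra
    haveI := hμ.numberField_muAlgValueField
    ∃ α₀ : ℂ ⊗[ℚ] bettiCohomology (X.A.baseChange ℂ).X 1, α₀ ≠ 0 ∧
      ∀ k : muAlgValueField L μ,
        (hOneAlgHom ((AbelianVariety.endAlgebra.mapRingHom (X.A.endBaseChange ℂ)).toRingHom.comp X.i) k).baseChange ℂ α₀ =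
          ((k : muAlgValueField L μ) : ℂ) • α₀ := by
  letI := ι₁.toAlgebra
  haveI := hμ.numberField_muAlgValueField
  set φ := (AbelianVariety.endAlgebra.mapRingHom (X.A.endBaseChange ℂ)).toRingHom.comp X.i with hφ
  have h1 := finrank_eigenline_complexAction_liu_eq_one ι₁ X
  -- a non-zero vector of the line
  have hne : eigenline (complexAction φ) (muAlgValueField L μ).subtype ≠ ⊥ := by
    intro h
    rw [h, finrank_bot] at h1
    exact zero_ne_one h1
  obtain ⟨w, hw, hw0⟩ := Submodule.exists_mem_ne_zero_of_ne_bot hne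
  refine ⟨(βA (X.A.baseChange ℂ)).symm w, fun h0 => hw0 ?_, fun k => ?_⟩
  · rw [← (βA (X.A.baseChange ℂ)).apply_symm_apply w, h0, map_zero]
  · apply (βA (X.A.baseChange ℂ)).injective
    rw [← complexAction_βA, LinearEquiv.apply_symm_apply, map_smul, LinearEquiv.apply_symm_apply]
    rw [eigenline, Submodule.mem_iInf] at hw
    exact (Module.End.mem_eigenspace_iff.mp (hw k))

end Summit.HodgeConjecture.CorCM.D2Bridge

end
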